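import Literature.Geometry.Riemannian.SphereLocalIsometry
import Literature.Geometry.Riemannian.RicciFlowScaling
import HarnessLib

/-!
# The Killing–Hopf theorem for positive curvature, quotient form (Lee 2018, Thm. 12.4, Cor. 12.5)

Lee, *Introduction to Riemannian Manifolds*, 2nd ed. (2018), Thm. 12.4 (Killing–Hopf): a
complete, simply connected Riemannian `n`-manifold (`n ≥ 2`) of constant sectional curvature
`c > 0` is isometric to the round sphere of radius `1/√c`; Cor. 12.5: every complete connected
manifold of constant curvature is a quotient of the model by a discrete group of isometries acting
freely; Problem 5-11: the isometries of the round sphere are the restrictions of `O(n+1)`. This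
file proves the **quotient form for compact manifolds and `c > 0`** directly from the local
isometry `F : Sⁿ → M` of `SphereLocalIsometry.lean`, without covering-space theory
(namespace `KillingHopf`; everything PROVED):

* `isLocalDiffeomorph_of_isometric`, `surjective_of_isLocalDiffeomorph` — an isometric `C^∞` map
  `Sⁿ → Mⁿ` is a local diffeomorphism, onto when `M` is connected (open-closed range);
* `exists_linearIsometryEquiv` — a linear `Θ : T_x Sⁿ → T_y Sⁿ` isometric for `g_round` extends
  to `A ∈ O(V)` with `A x = y`, `A ∘ dι_x = dι_y ∘ Θ` (orthonormal bases `(x, dι e_i)`,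
  `(y, dι Θe_i)` of `V`);
* `deckGroup V F ≤ O(V)` — the `A` with `F ∘ sphereMap A = F`;
  `exists_mem_deckGroup_apply_eq` — **fibres of `F` are orbits**: for `F x = F y`, extend
  `(dF_y)⁻¹ dF_x` to `A ∈ O(V)`; `F ∘ sphereMap A` and `F` are isometric with the same 1-jet at
  `x`, hence equal (`IsometryRigidity.eq_of_isometry_of_oneJet_eq`);
  `eq_one_of_mem_deckGroup_of_apply_eq` — **the action is free** (differentiate `F ∘ Â = F` at a
  fixed point);
* `exists_orthogonal_quotient_one`, `exists_orthogonal_quotient` — **the theorem**: a compact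
  connected Riemannian `n`-manifold (`n ≥ 2`) of constant sectional curvature `c > 0` admits
  `Γ ≤ O(V)` acting freely on `Sⁿ` and a surjective `C^∞` local diffeomorphism `q : Sⁿ → M` whose
  fibres are exactly the `Γ`-orbits (reduction `c → 1` by `g ↦ c • g`, `RicciFlowScaling.lean`).

For `n = 4`, `V = ℝ⁵` this is hypothesis (H2) of
`hamilton_positiveCurvatureOperator_classification_four_of_constantCurvature_of_killingHopf`
(`HamiltonPCOClassificationKillingHopf.lean`). No named facts (D-0026).

## References

* J. M. Lee, *Introduction to Riemannian Manifolds*, 2nd ed., GTM 176, Springer (2018):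
  Prop. 5.22, Problem 5-11, Cor. 12.3, Thm. 12.4, Cor. 12.5, Problem 12-2. [Lee2018]
* M. P. do Carmo, *Riemannian Geometry*, Birkhäuser (1992), Ch. 8, §4 (space forms),
  Thm. 4.1. [doCarmo1992]
* J. A. Wolf, *Spaces of constant curvature*, 6th ed. (2011), Thm. 2.4.9, §2.5. [Wolf2011]
-/

noncomputable section

open Bundle Set Function Filter Metric Module
open scoped Manifold ContDiff Topology RealInnerProductSpace

namespace Literature.Geometry.Riemannian

open Lorentzian Lorentzian.PseudoRiemannianMetric

namespace KillingHopf

variable {V : Type*} [NormedAddCommGroup V] [InnerProductSpace ℝ V] {n : ℕ}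
  [Fact (finrank ℝ V = n + 1)]
  {E : Type*} [NormedAddCommGroup E] [NormedSpace ℝ E] {H : Type*} [TopologicalSpace H]
  {I : ModelWithCorners ℝ E H} [I.Boundaryless] {M : Type*} [TopologicalSpace M]
  [ChartedSpace H M] [IsManifold I ∞ M] [FiniteDimensional ℝ E]
  {g : PseudoRiemannianMetric I ∞ E (TangentSpace I : M → Type _)}

/-- `dι[y]`: the differential at `y` of the inclusion `ι : Sⁿ ↪ V`, as a map into `V`. -/
local notation "dι[" y "]" => mvfderiv (𝓡 n) (Subtype.val : sphere (0 : V) 1 → V) y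

/-- Local notation for the model space `ℝⁿ` of the sphere charts (and tangent spaces). -/
local notation "ES" => EuclideanSpace ℝ (Fin n)

/-! ### Isometric maps from the round sphere are local diffeomorphisms, onto if `M` is connected -/

omit [I.Boundaryless] [FiniteDimensional ℝ E] in
/-- The differential of a map isometric for `g_round` (and any `g`) is injective:
`g(dF X, dF X) = g_round(X, X) > 0` for `X ≠ 0`. [folklore] -/
theorem mfderiv_injective_of_isometric {F : sphere (0 : V) 1 → M} {x : sphere (0 : V) 1}
    (hiso : ∀ X Y : TangentSpace (𝓡 n) x, g.val (F x) (mfderiv (𝓡 n) I F x X)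
      (mfderiv (𝓡 n) I F x Y) = (roundMetric (n := n) V).val x X Y) :
    Injective (mfderiv (𝓡 n) I F x) := by
  rw [injective_iff_map_eq_zero]
  intro X hX
  have h := hiso X X
  rw [hX, map_zero] at h
  exact CartanHadamard.eq_zero_of_val_self_eq_zero isRiemannian_roundMetric x h.symm

/-- **An isometric `C^∞` map `Sⁿ → Mⁿ` is a local diffeomorphism** (inverse function theorem).
[folklore] -/
theorem isLocalDiffeomorph_of_isometric (hdim : finrank ℝ E = n) {F : sphere (0 : V) 1 → M}
    (hF : ContMDiff (𝓡 n) I ∞ F)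
    (hiso : ∀ (x : sphere (0 : V) 1) (X Y : TangentSpace (𝓡 n) x), g.val (F x)
      (mfderiv (𝓡 n) I F x X) (mfderiv (𝓡 n) I F x Y) = (roundMetric (n := n) V).val x X Y) :
    IsLocalDiffeomorph (𝓡 n) I ∞ F := by
  intro x
  have hinj := mfderiv_injective_of_isometric (hiso x)
  have hdim' : finrank ℝ ES = finrank ℝ E := by rw [hdim, finrank_euclideanSpace_fin]
  set L : ES ≃ₗ[ℝ] E := mfderivEquivOfInjective (I := I) (I' := 𝓡 n) F x hinj hdim' with hL
  refine Literature.Topology.FourManifolds.isLocalDiffeomorphAt_of_mfderiv isOpen_univ (mem_univ x)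
    hF.contMDiffOn (by exact_mod_cast le_top) L.toContinuousLinearEquiv ?_
  ext u
  rfl

omit [Fact (finrank ℝ V = n + 1)] [I.Boundaryless] [IsManifold I ∞ M] [FiniteDimensional ℝ E] in
/-- **A local diffeomorphism from the (compact) sphere to a connected manifold is onto**: its
range is open (local diffeomorphisms are open maps), closed (compact) and nonempty.
[folklore] -/
theorem surjective_of_isLocalDiffeomorph [Fact (finrank ℝ V = n + 1)] [T2Space M]
    [ConnectedSpace M] {F : sphere (0 : V) 1 → M} (hF : IsLocalDiffeomorph (𝓡 n) I ∞ F) :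
    Surjective F := by
  haveI : FiniteDimensional ℝ V := .of_fact_finrank_eq_succ n
  haveI : ProperSpace V := FiniteDimensional.proper ℝ V
  haveI : Nonempty (sphere (0 : V) 1) := by
    haveI : Nontrivial V := Module.nontrivial_of_finrank_pos
      (by rw [(Fact.out : finrank ℝ V = n + 1)]; omega)
    exact (NormedSpace.sphere_nonempty.2 zero_le_one).to_subtype
  have hopen : IsOpen (range F) := hF.isOpen_range
  have hclosed : IsClosed (range F) := (isCompact_range hF.contMDiff.continuous).isClosed
  have hclopen : IsClopen (range F) := ⟨hclosed, hopen⟩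
  rcases isClopen_iff.1 hclopen with h | h
  · exact absurd h (range_nonempty F).ne_empty
  · exact range_eq_univ.1 h

/-! ### Linear isometries of `V` and the round sphere -/

omit [Fact (finrank ℝ V = n + 1)] in
/-- **`sphereMap A` is isometric for the round metric, pointwise**:
`g_round(dÂ X, dÂ Y) = g_round(X, Y)`. [cite: Lee2018, Problem 5-11] -/
theorem val_mfderiv_sphereMap [Fact (finrank ℝ V = n + 1)] (A : V ≃ₗᵢ[ℝ] V) (x : sphere (0 : V) 1)
    (X Y : TangentSpace (𝓡 n) x) :
    (roundMetric (n := n) V).val (sphereMap A x) (mfderiv (𝓡 n) (𝓡 n) (sphereMap A) x X)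
      (mfderiv (𝓡 n) (𝓡 n) (sphereMap A) x Y) = (roundMetric (n := n) V).val x X Y := by
  rw [roundMetric_val_eq_inner, roundMetric_val_eq_inner, mvfderiv_coe_sphereMap,
    mvfderiv_coe_sphereMap, A.inner_map_map]

omit [Fact (finrank ℝ V = n + 1)] in
/-- **Reading `dÂ` through the chain rule**: if `A x = y` (as vectors) and `A (dι_x v) = dι_y w`
then `d(sphereMap A)_x v = w`. [folklore] -/
theorem mfderiv_sphereMap_eq [Fact (finrank ℝ V = n + 1)] {A : V ≃ₗᵢ[ℝ] V} {x y : sphere (0 : V) 1}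
    (hxy : sphereMap A x = y) {v : TangentSpace (𝓡 n) x} {w : TangentSpace (𝓡 n) y}
    (hvw : A (dι[x] v) = dι[y] w) :
    (mfderiv (𝓡 n) (𝓡 n) (sphereMap A) x v : ES) = w := by
  have h1 := mvfderiv_coe_sphereMap (n := n) A x v
  rw [hvw] at h1
  have h2 : (dι[sphereMap A x] (mfderiv (𝓡 n) (𝓡 n) (sphereMap A) x v) : V) =
      dι[y] (mfderiv (𝓡 n) (𝓡 n) (sphereMap A) x v) :=
    CartanHadamard.mfderiv_congr_point (I := 𝓘(ℝ, V)) (I' := 𝓡 n) hxy _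
  rw [h2] at h1
  exact mfderiv_coe_sphere_injective (n := n) y h1

/-- **Extension of a tangent isometry to an ambient linear isometry.** For `x, y ∈ Sⁿ` and a linear
`Θ : T_x Sⁿ → T_y Sⁿ` isometric for the round metric, there is `A ∈ O(V)` with `A x = y` and
`A ∘ dι_x = dι_y ∘ Θ` (map the orthonormal basis `(x, dι_x e_i)` of `V` to `(y, dι_y Θ e_i)`,
`e` an orthonormal basis of `(T_x Sⁿ, g_round)`). Lee 2018, Prop. 3.3 / Problem 5-11 (the round
sphere is frame-homogeneous under `O(n+1)`). [cite: Lee2018, Problem 5-11] -/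
theorem exists_linearIsometryEquiv (x y : sphere (0 : V) 1) (Θ : ES →ₗ[ℝ] ES)
    (hΘ : ∀ u w : ES, (roundMetric (n := n) V).val y (show TangentSpace (𝓡 n) y from Θ u)
      (show TangentSpace (𝓡 n) y from Θ w) = (roundMetric (n := n) V).val x u w) :
    ∃ A : V ≃ₗᵢ[ℝ] V, A x = y ∧ ∀ v : ES, A (dι[x] v) = dι[y] (Θ v) := by
  letI r1 := (roundMetric (n := n) V).riemannianBundle isRiemannian_roundMetric
  haveI : FiniteDimensional ℝ (TangentSpace (𝓡 n) x) :=
    inferInstanceAs (FiniteDimensional ℝ (EuclideanSpace ℝ (Fin n)))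
  haveI : FiniteDimensional ℝ V := .of_fact_finrank_eq_succ n
  have h1 : finrank ℝ (TangentSpace (𝓡 n) x) = n := finrank_euclideanSpace_fin
  -- an orthonormal basis of `T_x Sⁿ` for `g_round`
  set e : OrthonormalBasis (Fin n) ℝ (TangentSpace (𝓡 n) x) :=
    (stdOrthonormalBasis ℝ (TangentSpace (𝓡 n) x)).reindex (finCongr h1) with he
  have heo : ∀ i j : Fin n, ⟪dι[x] (e i), dι[x] (e j)⟫ = if i = j then 1 else 0 := by
    intro i j
    rw [← roundMetric_val_eq_inner, ← (roundMetric (n := n) V).inner_eq isRiemannian_roundMetric]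
    exact orthonormal_iff_ite.1 e.orthonormal i j
  have heo' : ∀ i j : Fin n, ⟪dι[y] (Θ (e i)), dι[y] (Θ (e j))⟫ = if i = j then 1 else 0 := by
    intro i j
    rw [← roundMetric_val_eq_inner, hΘ, roundMetric_val_eq_inner]
    exact heo i j
  have hxx : ⟪(x : V), (x : V)⟫ = 1 := by
    rw [real_inner_self_eq_norm_sq, norm_eq_of_mem_sphere, one_pow]
  have hyy : ⟪(y : V), (y : V)⟫ = 1 := by
    rw [real_inner_self_eq_norm_sq, norm_eq_of_mem_sphere, one_pow]
  -- the two orthonormal families of `V`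
  set bx : Fin (n + 1) → V := Fin.cons (x : V) (fun i ↦ dι[x] (e i)) with hbx
  set bY : Fin (n + 1) → V := Fin.cons (y : V) (fun i ↦ dι[y] (Θ (e i))) with hbY
  have hon : ∀ (z : sphere (0 : V) 1) (f : Fin n → V) (hzz : ⟪(z : V), (z : V)⟫ = 1)
      (hzf : ∀ i, ⟪(z : V), f i⟫ = 0) (hff : ∀ i j, ⟪f i, f j⟫ = if i = j then 1 else 0),
      Orthonormal ℝ (Fin.cons (z : V) f : Fin (n + 1) → V) := by
    intro z f hzz hzf hff
    rw [orthonormal_iff_ite]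
    intro i j
    refine Fin.cases ?_ (fun i ↦ ?_) i <;> refine Fin.cases ?_ (fun j ↦ ?_) j
    · rw [if_pos rfl]; exact hzz
    · simp only [Fin.cons_zero, Fin.cons_succ, hzf]
      rw [if_neg (Fin.succ_ne_zero j).symm]
    · simp only [Fin.cons_zero, Fin.cons_succ, real_inner_comm, hzf]
      rw [if_neg (Fin.succ_ne_zero i)]
    · simp only [Fin.cons_succ, hff, Fin.succ_inj]
  have hbxo : Orthonormal ℝ bx :=
    hon x _ hxx (fun i ↦ inner_coe_mvfderiv_coe_sphere x (e i)) heo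
  have hbYo : Orthonormal ℝ bY :=
    hon y _ hyy (fun i ↦ inner_coe_mvfderiv_coe_sphere y (Θ (e i))) heo'
  have hcard : Fintype.card (Fin (n + 1)) = finrank ℝ V := by
    rw [Fintype.card_fin, (Fact.out : finrank ℝ V = n + 1)]
  have hspx : ⊤ ≤ Submodule.span ℝ (Set.range bx) :=
    (basisOfOrthonormalOfCardEqFinrank hbxo hcard).span_eq.symm.le.trans
      (by rw [coe_basisOfOrthonormalOfCardEqFinrank])
  have hspY : ⊤ ≤ Submodule.span ℝ (Set.range bY) :=
    (basisOfOrthonormalOfCardEqFinrank hbYo hcard).span_eq.symm.le.trans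
      (by rw [coe_basisOfOrthonormalOfCardEqFinrank])
  set Bx := OrthonormalBasis.mk hbxo hspx with hBx
  set BY := OrthonormalBasis.mk hbYo hspY with hBY
  set A : V ≃ₗᵢ[ℝ] V := Bx.equiv BY (Equiv.refl _) with hA
  have hAb : ∀ i, A (bx i) = bY i := by
    intro i
    have h := Bx.equiv_apply_basis BY (Equiv.refl _) i
    rw [hBx, hBY, OrthonormalBasis.coe_mk, OrthonormalBasis.coe_mk] at h
    exact h
  refine ⟨A, ?_, fun v ↦ ?_⟩
  · have h := hAb 0
    simp only [hbx, hbY, Fin.cons_zero] at h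
    exact h
  · -- both sides are linear in `v` and agree on the basis `e`
    have hlin : (A.toLinearEquiv.toLinearMap.comp (dι[x]).toLinearMap :
        TangentSpace (𝓡 n) x →ₗ[ℝ] V) =
        ((dι[y]).toLinearMap.comp (show TangentSpace (𝓡 n) x →ₗ[ℝ] TangentSpace (𝓡 n) y from Θ)) := by
      refine e.toBasis.ext fun i ↦ ?_
      simp only [OrthonormalBasis.coe_toBasis, LinearMap.coe_comp, Function.comp_apply,
        ContinuousLinearMap.coe_coe, LinearEquiv.coe_coe, LinearIsometryEquiv.coe_toLinearEquiv]
      have h := hAb i.succ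
      simp only [hbx, hbY, Fin.cons_succ] at h
      exact h
    exact LinearMap.congr_fun hlin v

/-! ### The deck group of an isometric map from the sphere -/

variable (V) in
/-- **The deck group** of a map `F : Sⁿ → M`: the linear isometries `A` of `V` with
`F ∘ sphereMap A = F`, as a subgroup of `O(V)`. [cite: Lee2018, Cor. 12.5] -/
def deckGroup (F : sphere (0 : V) 1 → M) : Subgroup (V ≃ₗᵢ[ℝ] V) where
  carrier := {A | ∀ x : sphere (0 : V) 1, F (sphereMap A x) = F x}
  one_mem' x := by
    have h : sphereMap (1 : V ≃ₗᵢ[ℝ] V) x = x := Subtype.ext rfl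
    rw [h]
  mul_mem' {A B} hA hB x := by
    have h : sphereMap (A * B) x = sphereMap A (sphereMap B x) := Subtype.ext rfl
    rw [h, hA, hB]
  inv_mem' {A} hA x := by
    have h := hA (sphereMap A⁻¹ x)
    have h' : sphereMap A (sphereMap A⁻¹ x) = x := Subtype.ext (by simp)
    rw [h'] at h
    exact h.symm

omit [Fact (finrank ℝ V = n + 1)] [TopologicalSpace M] in
/-- Membership in the deck group. [folklore] -/
theorem mem_deckGroup {F : sphere (0 : V) 1 → M} {A : V ≃ₗᵢ[ℝ] V} :
    A ∈ deckGroup V F ↔ ∀ x : sphere (0 : V) 1, F (sphereMap A x) = F x := Iff.rfl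


/-! ### Fibres are orbits, and the action is free -/

section Orbits

variable [T2Space M]


omit [I.Boundaryless] [FiniteDimensional ℝ E] [T2Space M] in
/-- **Composition with an ambient isometry stays isometric**: for `G = F ∘ sphereMap A`,
`g(dG X, dG Y) = g_round(X, Y)` when `F` is isometric. [folklore] -/
theorem isometric_comp_sphereMap {F : sphere (0 : V) 1 → M} (hF : ContMDiff (𝓡 n) I ∞ F)
    (hiso : ∀ (x : sphere (0 : V) 1) (X Y : TangentSpace (𝓡 n) x), g.val (F x)
      (mfderiv (𝓡 n) I F x X) (mfderiv (𝓡 n) I F x Y) = (roundMetric (n := n) V).val x X Y)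
    (A : V ≃ₗᵢ[ℝ] V) (x : sphere (0 : V) 1) (X Y : TangentSpace (𝓡 n) x) :
    g.val ((F ∘ sphereMap A) x) (mfderiv (𝓡 n) I (F ∘ sphereMap A) x X)
      (mfderiv (𝓡 n) I (F ∘ sphereMap A) x Y) = (roundMetric (n := n) V).val x X Y := by
  have h1 : MDifferentiableAt (𝓡 n) I F (sphereMap A x) := (hF _).mdifferentiableAt (by simp)
  have h2 : MDifferentiableAt (𝓡 n) (𝓡 n) (sphereMap A) x :=
    (contMDiff_sphereMap A (m := 1) x).mdifferentiableAt one_ne_zero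
  have e : ∀ Z : TangentSpace (𝓡 n) x, mfderiv (𝓡 n) I (F ∘ sphereMap A) x Z =
      mfderiv (𝓡 n) I F (sphereMap A x) (mfderiv (𝓡 n) (𝓡 n) (sphereMap A) x Z) := by
    intro Z; rw [mfderiv_comp x h1 h2]; rfl
  rw [e, e]
  show g.val (F (sphereMap A x)) _ _ = _
  rw [hiso (sphereMap A x), val_mfderiv_sphereMap]

/-- **The fibres of an isometric `C^∞` map `F : Sⁿ → M` are orbits of its deck group** (`n ≥ 1`):
if `F x = F y` there is `A ∈ O(V)` with `F ∘ sphereMap A = F` and `A x = y` — extend the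
tangent isometry `(dF_y)⁻¹ ∘ dF_x` to `A ∈ O(V)` with `A x = y` (`exists_linearIsometryEquiv`);
then `F ∘ sphereMap A` and `F` are isometric maps with the same 1-jet at `x`, hence equal
(`IsometryRigidity.eq_of_isometry_of_oneJet_eq`). Lee 2018, proof of Thm. 12.4 / Cor. 12.5
(without passing through the universal cover). [cite: Lee2018, Cor. 12.5] -/
theorem exists_mem_deckGroup_apply_eq (hn : 1 ≤ n) (hdim : finrank ℝ E = n)
    {F : sphere (0 : V) 1 → M} (hF : ContMDiff (𝓡 n) I ∞ F)
    (hiso : ∀ (x : sphere (0 : V) 1) (X Y : TangentSpace (𝓡 n) x), g.val (F x)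
      (mfderiv (𝓡 n) I F x X) (mfderiv (𝓡 n) I F x Y) = (roundMetric (n := n) V).val x X Y)
    {x y : sphere (0 : V) 1} (hxy : F x = F y) :
    ∃ A ∈ deckGroup V F, A x = (y : V) := by
  haveI : FiniteDimensional ℝ V := .of_fact_finrank_eq_succ n
  -- the sphere is connected
  haveI : PreconnectedSpace (sphere (0 : V) 1) := by
    have hrank : 1 < Module.rank ℝ V := by
      rw [← Module.finrank_eq_rank, (Fact.out : finrank ℝ V = n + 1)]; exact_mod_cast (by omega)
    exact isPreconnected_iff_preconnectedSpace.1
      (isConnected_sphere hrank (0 : V) zero_le_one).isPreconnected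
  have hdim' : finrank ℝ ES = finrank ℝ E := by rw [hdim, finrank_euclideanSpace_fin]
  -- the tangent isometry `Θ = (dF_y)⁻¹ ∘ dF_x`
  have hinj := mfderiv_injective_of_isometric (hiso y)
  set Ly := mfderivEquivOfInjective (I := I) (I' := 𝓡 n) F y hinj hdim' with hLy
  set Θ : ES →ₗ[ℝ] ES := (Ly.symm.toLinearMap.comp
    (show ES →ₗ[ℝ] E from (mfderiv (𝓡 n) I F x).toLinearMap)) with hΘ
  have hΘy : ∀ v : ES, (mfderiv (𝓡 n) I F y (show TangentSpace (𝓡 n) y from Θ v) : E) =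
      mfderiv (𝓡 n) I F x v := fun v ↦
    mfderiv_mfderivEquivOfInjective_symm (I := I) (I' := 𝓡 n) F y hinj hdim' _
  have hΘiso : ∀ u w : ES, (roundMetric (n := n) V).val y (show TangentSpace (𝓡 n) y from Θ u)
      (show TangentSpace (𝓡 n) y from Θ w) = (roundMetric (n := n) V).val x u w := by
    intro u w
    rw [← hiso y, hΘy, hΘy, ← hiso x]
    exact val_congr_point (g := g) hxy.symm _ _
  -- the ambient isometry
  obtain ⟨A, hAx, hAv⟩ := exists_linearIsometryEquiv x y Θ hΘiso
  have hAx' : sphereMap A x = y := Subtype.ext hAx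
  have hdA : ∀ v : ES, (mfderiv (𝓡 n) (𝓡 n) (sphereMap A) x v : ES) = Θ v :=
    fun v ↦ mfderiv_sphereMap_eq hAx' (hAv v)
  -- `F ∘ sphereMap A` and `F` have the same 1-jet at `x`
  set G : sphere (0 : V) 1 → M := F ∘ sphereMap A with hG
  have hGs : ContMDiff (𝓡 n) I ∞ G := hF.comp (contMDiff_sphereMap A)
  have hGiso := isometric_comp_sphereMap hF hiso A
  have h0 : G x = F x := by show F (sphereMap A x) = F x; rw [hAx', hxy]
  have h1 : mfderiv (𝓡 n) I G x = mfderiv (𝓡 n) I F x := by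
    have hd1 : MDifferentiableAt (𝓡 n) I F (sphereMap A x) := (hF _).mdifferentiableAt (by simp)
    have hd2 : MDifferentiableAt (𝓡 n) (𝓡 n) (sphereMap A) x :=
      (contMDiff_sphereMap A (m := 1) x).mdifferentiableAt one_ne_zero
    ext v
    rw [hG, mfderiv_comp x hd1 hd2]
    show (mfderiv (𝓡 n) I F (sphereMap A x) (mfderiv (𝓡 n) (𝓡 n) (sphereMap A) x v) : E) = _
    rw [CartanHadamard.mfderiv_congr_point (I := I) (I' := 𝓡 n) hAx', hdA, hΘy]
    rfl
  have hGF : G = F :=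
    IsometryRigidity.eq_of_isometry_of_oneJet_eq (g := g) (gN := roundMetric (n := n) V) hdim'
      hGs hF hGiso hiso h0 h1
  exact ⟨A, fun z ↦ congrFun hGF z, hAx⟩

omit [I.Boundaryless] [FiniteDimensional ℝ E] [T2Space M] in
/-- **The deck group acts freely**: if `A ∈ deckGroup F` fixes a point `z` of the sphere then
`A = 1` — differentiating `F ∘ sphereMap A = F` at `z` gives `d(sphereMap A)_z = id` (as `dF_z`
is injective), so `A` fixes `z` and `z^⊥ = dι(T_z Sⁿ)`. Lee 2018, Prop. C.20 (the covering
automorphism group of a smooth covering acts freely), as used in the proof of Cor. 12.5.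
[cite: Lee2018, Prop. C.20 and Cor. 12.5] -/
theorem eq_one_of_mem_deckGroup_of_apply_eq {F : sphere (0 : V) 1 → M}
    (hF : ContMDiff (𝓡 n) I ∞ F)
    (hiso : ∀ (x : sphere (0 : V) 1) (X Y : TangentSpace (𝓡 n) x), g.val (F x)
      (mfderiv (𝓡 n) I F x X) (mfderiv (𝓡 n) I F x Y) = (roundMetric (n := n) V).val x X Y)
    {A : V ≃ₗᵢ[ℝ] V} (hA : A ∈ deckGroup V F) {z : sphere (0 : V) 1} (hz : A z = (z : V)) :
    A = 1 := by
  haveI : FiniteDimensional ℝ V := .of_fact_finrank_eq_succ n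
  have hz' : sphereMap A z = z := Subtype.ext hz
  -- `d(sphereMap A)_z = id`
  have hGF : F ∘ sphereMap A = F := funext fun x ↦ hA x
  have hd1 : MDifferentiableAt (𝓡 n) I F (sphereMap A z) := (hF _).mdifferentiableAt (by simp)
  have hd2 : MDifferentiableAt (𝓡 n) (𝓡 n) (sphereMap A) z :=
    (contMDiff_sphereMap A (m := 1) z).mdifferentiableAt one_ne_zero
  have hcomp := mfderiv_comp z hd1 hd2
  rw [hGF] at hcomp
  have hdA : ∀ v : ES, (mfderiv (𝓡 n) (𝓡 n) (sphereMap A) z v : ES) = v := by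
    intro v
    have h : (mfderiv (𝓡 n) I F z v : E) =
        mfderiv (𝓡 n) I F (sphereMap A z) (mfderiv (𝓡 n) (𝓡 n) (sphereMap A) z v) :=
      congrArg (fun f ↦ (f v : E)) hcomp
    rw [CartanHadamard.mfderiv_congr_point (I := I) (I' := 𝓡 n) hz'] at h
    exact (mfderiv_injective_of_isometric (hiso z) h).symm
  -- hence `A` fixes `dι(T_z Sⁿ) = z^⊥`
  have hfix : ∀ v : ES, A (dι[z] v) = dι[z] v := by
    intro v
    have h1 := mvfderiv_coe_sphereMap (n := n) A z v
    have h2 : (dι[sphereMap A z] (mfderiv (𝓡 n) (𝓡 n) (sphereMap A) z v) : V) =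
        dι[z] (mfderiv (𝓡 n) (𝓡 n) (sphereMap A) z v) :=
      CartanHadamard.mfderiv_congr_point (I := 𝓘(ℝ, V)) (I' := 𝓡 n) hz' _
    rw [h2, hdA] at h1
    exact h1.symm
  -- and `z`; conclude on `V = ℝ z ⊕ z^⊥`
  refine LinearIsometryEquiv.ext fun w ↦ ?_
  have hdec : (ℝ ∙ (z : V)).starProjection w + (ℝ ∙ (z : V))ᗮ.starProjection w = w :=
    (ℝ ∙ (z : V)).starProjection_add_starProjection_orthogonal w
  have h1 : A ((ℝ ∙ (z : V)).starProjection w) = (ℝ ∙ (z : V)).starProjection w := by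
    obtain ⟨c, hc⟩ := Submodule.mem_span_singleton.1 ((ℝ ∙ (z : V)).starProjection_apply_mem w)
    rw [← hc, map_smul, hz]
  have h2 : A ((ℝ ∙ (z : V))ᗮ.starProjection w) = (ℝ ∙ (z : V))ᗮ.starProjection w := by
    have hmem := (ℝ ∙ (z : V))ᗮ.starProjection_apply_mem w
    have h0 : ⟪(z : V), (ℝ ∙ (z : V))ᗮ.starProjection w⟫ = 0 :=
      Submodule.mem_orthogonal_singleton_iff_inner_right.1 hmem
    obtain ⟨v, hv⟩ := exists_mvfderiv_coe_sphere_eq (n := n) z h0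
    rw [← hv]
    exact hfix v
  rw [LinearIsometryEquiv.coe_one, id_eq, ← hdec, map_add, h1, h2]

end Orbits

/-! ### Finiteness of the deck group -/

omit [I.Boundaryless] [IsManifold I ∞ M] [FiniteDimensional ℝ E] in
/-- **The deck group of a local diffeomorphism from the compact sphere is finite** when it acts
freely: `γ ↦ γ x₀` injects it into the fibre `F⁻¹(F x₀)`, a closed (hence compact) subset of the
sphere which is discrete because `F` is locally injective. (Lee 2018, Cor. 12.5: the group is
discrete; here finite since the total space is compact.) [cite: Lee2018, Cor. 12.5] -/
theorem finite_deckGroup [T2Space M] {F : sphere (0 : V) 1 → M}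
    (hloc : IsLocalDiffeomorph (𝓡 n) I ∞ F)
    (hfree : ∀ A ∈ deckGroup V F, ∀ x : sphere (0 : V) 1, A x = (x : V) → A = 1) :
    Finite (deckGroup V F) := by
  haveI : FiniteDimensional ℝ V := .of_fact_finrank_eq_succ n
  haveI : ProperSpace V := FiniteDimensional.proper ℝ V
  haveI : Nonempty (sphere (0 : V) 1) := by
    haveI : Nontrivial V := Module.nontrivial_of_finrank_pos
      (by rw [(Fact.out : finrank ℝ V = n + 1)]; omega)
    exact (NormedSpace.sphere_nonempty.2 zero_le_one).to_subtype
  obtain ⟨x₀⟩ : Nonempty (sphere (0 : V) 1) := inferInstance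
  -- the fibre through `x₀` is finite
  set K : Set (sphere (0 : V) 1) := F ⁻¹' {F x₀} with hK
  have hKc : IsCompact K := (isClosed_singleton.preimage hloc.contMDiff.continuous).isCompact
  have hKf : K.Finite := by
    choose Φ hΦ using fun z : sphere (0 : V) 1 ↦ hloc z
    obtain ⟨t, ht⟩ := hKc.elim_finite_subcover (fun z : K ↦ (Φ (z : sphere (0 : V) 1)).source)
      (fun z ↦ (Φ (z : sphere (0 : V) 1)).open_source)
      (fun z hz ↦ mem_iUnion.2 ⟨⟨z, hz⟩, (hΦ z).1⟩)
    refine ((t.finite_toSet).image (fun z : K ↦ (z : sphere (0 : V) 1))).subset fun k hk ↦ ?_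
    obtain ⟨z, hzt, hkz⟩ := mem_iUnion₂.1 (ht hk)
    have hz : (z : sphere (0 : V) 1) ∈ (Φ (z : sphere (0 : V) 1)).source := (hΦ z).1
    have h1 : (Φ (z : sphere (0 : V) 1)) k = (Φ (z : sphere (0 : V) 1)) z := by
      rw [← (hΦ (z : sphere (0 : V) 1)).2 hkz, ← (hΦ (z : sphere (0 : V) 1)).2 hz]
      exact (show F k = F x₀ from hk).trans (show F z = F x₀ from z.2).symm
    have hkz' : k = z := (Φ (z : sphere (0 : V) 1)).injOn hkz hz h1
    exact ⟨z, hzt, hkz'.symm⟩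
  haveI : Finite K := hKf.to_subtype
  refine Finite.of_injective (fun γ : deckGroup V F ↦ (⟨sphereMap γ.1 x₀, γ.2 x₀⟩ : K)) ?_
  intro γ γ' h
  have h' : sphereMap γ.1 x₀ = sphereMap γ'.1 x₀ := congrArg Subtype.val h
  have hfix : (γ'.1⁻¹ * γ.1) x₀ = (x₀ : V) := by
    have h'' : γ.1 (x₀ : V) = γ'.1 (x₀ : V) := congrArg Subtype.val h'
    show γ'.1⁻¹ (γ.1 (x₀ : V)) = x₀
    rw [h'']
    exact γ'.1.symm_apply_apply (x₀ : V)
  have h1 := hfree _ (mul_mem (inv_mem γ'.2) γ.2) x₀ hfix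
  exact Subtype.ext (inv_mul_eq_one.1 h1).symm

/-! ### Assembly: the Killing–Hopf theorem for positive curvature, quotient form -/

/-- **Killing–Hopf, `K ≡ 1`, quotient form.** A compact connected Riemannian `n`-manifold
(`n ≥ 2`) of constant sectional curvature `1` (for the chosen Levi-Civita connection) is the
quotient of the round `Sⁿ` by a finite subgroup `Γ ≤ O(V)` acting freely: there is a surjective `C^∞`
local diffeomorphism `q : Sⁿ → M` whose fibres are exactly the `Γ`-orbits. Lee 2018, Thm. 12.4
(Killing–Hopf) with Cor. 12.5 and Problem 5-11; here assembled without covering-space theory: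
`q` is the local isometry of `SphereLocalIsometry.exists_isLocalIsometry` (onto since `Sⁿ` is
compact and `M` connected), `Γ` its deck group (`deckGroup`), fibres are orbits by
`exists_mem_deckGroup_apply_eq`, the action is free by `eq_one_of_mem_deckGroup_of_apply_eq`,
and `Γ` is finite by `finite_deckGroup`.
[cite: Lee2018, Thm. 12.4 and Cor. 12.5] -/
theorem exists_orthogonal_quotient_one (hn : 2 ≤ n) [T2Space M] [CompactSpace M] [ConnectedSpace M]
    [g.HasLeviCivita] (hg : g.IsRiemannian)
    (hK : g.HasConstantSectionalCurvatureWith g.leviCivita 1) (hdim : finrank ℝ E = n)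
    (p : sphere (0 : V) 1) :
    ∃ (Γ : Subgroup (V ≃ₗᵢ[ℝ] V)) (q : sphere (0 : V) 1 → M), Finite Γ ∧
      (∀ γ ∈ Γ, γ ≠ 1 → ∀ x : sphere (0 : V) 1, γ x ≠ (x : V)) ∧
        IsLocalDiffeomorph (𝓡 n) I ∞ q ∧ Surjective q ∧
        ∀ x y : sphere (0 : V) 1, q x = q y ↔ ∃ γ ∈ Γ, γ x = (y : V) := by
  haveI := (roundMetric (n := n) V).hasLeviCivita
  haveI : CompleteSpace E := FiniteDimensional.complete ℝ E
  have h2 : (2 : ℕ∞ω) ≤ ∞ := WithTop.coe_le_coe.2 le_top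
  have hc : IsGeodesicallyComplete g.leviCivita := g.isGeodesicallyComplete_of_compactSpace h2 hg
  obtain ⟨pt⟩ : Nonempty M := inferInstance
  obtain ⟨F, -, hF, hiso⟩ :=
    SphereLocalIsometry.exists_isLocalIsometry (V := V) hn hg hK hc hdim p pt
  have hloc := isLocalDiffeomorph_of_isometric hdim hF hiso
  have hfree : ∀ A ∈ deckGroup V F, ∀ x : sphere (0 : V) 1, A x = (x : V) → A = 1 :=
    fun A hA x hx ↦ eq_one_of_mem_deckGroup_of_apply_eq hF hiso hA hx
  refine ⟨deckGroup V F, F, finite_deckGroup hloc hfree, fun γ hγ hne x hx ↦ hne (hfree γ hγ x hx),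
    hloc, surjective_of_isLocalDiffeomorph hloc, fun x y ↦ ⟨fun h ↦ ?_, ?_⟩⟩
  · obtain ⟨A, hA, hAx⟩ := exists_mem_deckGroup_apply_eq (by omega) hdim hF hiso h
    exact ⟨A, hA, hAx⟩
  · rintro ⟨γ, hγ, hγx⟩
    have h : sphereMap γ x = y := Subtype.ext hγx
    rw [← h]
    exact (hγ x).symm

/-- **Killing–Hopf for constant curvature `c > 0`, quotient form** (Lee 2018, Thm. 12.4 with
Cor. 12.5: a compact connected Riemannian manifold of constant sectional curvature `c > 0` is a
quotient `Sⁿ(1/√c)/Γ`, `Γ ≤ O(n+1)` acting freely; after the dilation `Sⁿ → Sⁿ(1/√c)` this is a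
free orthogonal quotient of the unit sphere). Reduced to `c = 1` by scaling the metric:
`c • g` has the same Levi-Civita connection and constant curvature `1`
(`curvatureForm_constSmul`). Hypothesis: `g.HasConstantSectionalCurvature c`, i.e. for every
Levi-Civita connection of `g`. [cite: Lee2018, Thm. 12.4 and Cor. 12.5] -/
theorem exists_orthogonal_quotient (hn : 2 ≤ n) [T2Space M] [CompactSpace M] [ConnectedSpace M]
    {c : ℝ} (hc : 0 < c) (hg : g.IsRiemannian) (hK : g.HasConstantSectionalCurvature c)
    (hdim : finrank ℝ E = n) (p : sphere (0 : V) 1) :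
    ∃ (Γ : Subgroup (V ≃ₗᵢ[ℝ] V)) (q : sphere (0 : V) 1 → M), Finite Γ ∧
      (∀ γ ∈ Γ, γ ≠ 1 → ∀ x : sphere (0 : V) 1, γ x ≠ (x : V)) ∧
        IsLocalDiffeomorph (𝓡 n) I ∞ q ∧ Surjective q ∧
        ∀ x y : sphere (0 : V) 1, q x = q y ↔ ∃ γ ∈ Γ, γ x = (y : V) := by
  haveI : CompleteSpace E := FiniteDimensional.complete ℝ E
  set g' := g.constSmul c hc.ne' with hg'def
  haveI := g'.hasLeviCivita
  have hg' : g'.IsRiemannian := hg.constSmul hc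
  -- `g'.leviCivita` is a Levi-Civita connection of `g`, so `(g, ∇')` has constant curvature `c`
  have hLC' : g'.IsLeviCivita g'.leviCivita := isLeviCivita_leviCivita_holds (g := g')
  have hLC : g.IsLeviCivita g'.leviCivita := (isLeviCivita_constSmul_iff hc.ne').1 hLC'
  have hKc : g.HasConstantSectionalCurvatureWith g'.leviCivita c := hK _ hLC
  have hK1 : g'.HasConstantSectionalCurvatureWith g'.leviCivita 1 := by
    intro x X Y Z W
    show (g.constSmul c hc.ne').curvatureForm g'.leviCivita x X Y Z W =
      1 * ((g.constSmul c hc.ne').val x Y Z * (g.constSmul c hc.ne').val x X W -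
        (g.constSmul c hc.ne').val x X Z * (g.constSmul c hc.ne').val x Y W)
    rw [curvatureForm_constSmul, hKc.curvatureForm_eq]
    simp only [constSmul_apply]
    ring
  exact exists_orthogonal_quotient_one hn hg' hK1 hdim p

end KillingHopf

end Literature.Geometry.Riemannian
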